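import Literature.Computability.Complexity.CMMSASquaring
import Literature.Computability.Complexity.CSPToCMMSAMachine
import Literature.Computability.Complexity.CodeFPBudgets
import Literature.Computability.Complexity.PromiseProofs
import HarnessLib

/-!
# Self-improvement of constant-gap CMMSA, II: the squaring map is a Karp reduction

Topic `Computability/Complexity`. The squaring map `CMMSASquare.square K` of `CMMSASquaring.lean`
(Alekhnovich–Buss–Moran–Pitassi 2001, §2, Lemma 2, made collective and distributed into small DNFs)
is computed on the codes of CMMSA instances (`CMMSAInstance.encoding`: Hirahara 2022, Def. 5.1) by a
polynomial-time string function. The program is written in the typed `CodeFP` algebra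
(`CodeFP.lean`, `CodeFPBudgets.lean`) on the instance tuples `TO = ℕ × List (List (List ℕ)) × List ℕ × ℕ`
of `CSPToCMMSAMachine.lean` (code `toE`): nested `map`/`flatten`/`filter` programs and, for the
sections truncated at the constant depth `K`, a `K`-fold composition of one `rawCases` round — every
stage unconditionally polynomial, so no size invariant has to be threaded.

* `CMMSASquare.codeFP_sectionsK` — `sectionsK K` on raw codes, by induction on `K`;
* `CMMSASquare.codeFP_sqWeight`, `codeFP_choices`, `codeFP_secFormula`, `codeFP_sqFormulas`;
* `CMMSASquare.codeFP_square` — **`square K` is polynomial time on codes**;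
* `CMMSASquare.polyTimeReducible_square` — **the Karp reduction
  `gapCMMSA g 1 K ≤ₚ gapCMMSA g² 1 (K·K)`** (`g ≥ 1` constant), and its iterate
  `CMMSASquare.polyTimeReducible_iterate` / `isNPHard_gapCMMSA_iterate`:
  `gapCMMSA g 1 K ≤ₚ gapCMMSA (g^(2^r)) 1 (K^(2^r))` for every `r`.

## References

* M. Alekhnovich, S. Buss, S. Moran, T. Pitassi, *Minimum propositional proof length is NP-hard to
  linearly approximate*, J. Symbolic Logic 66 (2001) 171–191, §2, Lemma 2 and proof of Thm. 3
  (self-improvement, iterated `k` times the gap becomes `g^{2^k}`… there: `2^k`) [AlekhnovichEtAl2001].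
* S. Hirahara, *NP-hardness of learning programs and partial MCSP*, ECCC TR22-119, Def. 5.1
  [Hirahara2022PartialMCSP].
* S. Arora, B. Barak, *Computational Complexity: A Modern Approach*, CUP 2009, §1.3 (closure of
  polynomial time under composition and bounded loops) [AroraBarak2009].
-/

namespace Literature.Computability.Complexity

open _root_.Computability MetaComplexity CodeFP
open CSPToCMMSAMachine (TO toE toE_eq)

namespace CMMSASquare

/-! ### Raw codes of terms, formulas and choice items -/

/-- A term, raw: `rawE natE`. -/
local notation "tE" => rawE natE

/-- A monotone DNF, raw terms of raw literals: `rawE (rawE natE)`. -/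
local notation "fE" => rawE (rawE natE)

/-- A choice item `(i, φ')`: `pairE natE fE`. -/
local notation "qE" => pairE natE (rawE (rawE natE))

/-- Re-reading a `listE`-coded formula raw. [folklore] -/
theorem codeFP_fRaw : CodeFP (listE (listE natE)) fE id :=
  ((map₀ (rawOfList natE)).comp (rawOfList (listE natE))).congr fun φ => by simp

/-- Re-heading a raw formula. [folklore] -/
theorem codeFP_fList : CodeFP fE (listE (listE natE)) id :=
  ((listOfRaw (listE natE)).comp (map₀ (listOfRaw natE))).congr fun φ => by simp

/-- Re-reading a `listE`-coded collection raw. [folklore] -/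
theorem codeFP_collRaw : CodeFP (listE (listE (listE natE))) (rawE fE) id :=
  ((map₀ codeFP_fRaw).comp (rawOfList (listE (listE natE)))).congr fun Φ => by simp

/-- Re-heading a raw collection. [folklore] -/
theorem codeFP_collList : CodeFP (rawE fE) (listE (listE (listE natE))) id :=
  ((listOfRaw (listE (listE natE))).comp (map₀ codeFP_fList)).congr fun Φ => by simp

/-! ### Weights -/

/-- Unary multiplication. [cite: AroraBarak2009, §1.3] -/
theorem unMul : CodeFP (pairE unE unE) unE (fun p => p.1 * p.2) :=
  ((ulength unitE).comp (unitsMul.comp ((replicateUnit.comp (fst _ _)).pair (replicateUnit.comp (snd _ _))))).congr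
    fun p => by simp

/-- **The product weights `sqWeight` on raw unary lists.** [cite: AlekhnovichEtAl2001, §2, Lemma 2] -/
theorem codeFP_sqWeight : CodeFP (rawE unE) (rawE unE) sqWeight := by
  have hin : CodeFP (pairE unE (rawE unE)) (rawE unE) (fun p => p.2.map fun b => p.1 * b) := map unMul
  have hout : CodeFP (pairE (rawE unE) (rawE unE)) (rawE (rawE unE))
      (fun p => p.2.map fun a => p.1.map fun b => a * b) :=
    map (hin.comp ((snd _ _).pair (fst _ _)))
  exact ((flatten unE).comp (hout.comp ((CodeFP.id _).pair (CodeFP.id _)))).congr fun w => rfl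

/-! ### Formulas -/

/-- `rowTerm n i t` with context `(n, i)`. [cite: AlekhnovichEtAl2001, §2, Lemma 2] -/
theorem codeFP_rowTerm : CodeFP (pairE (pairE natE natE) tE) tE (fun p => rowTerm p.1.1 p.1.2 p.2) :=
  (map (natAdd.comp ((natMul.comp ((fst _ _).snd'.pair (fst _ _).fst')).pair (snd _ _)))).congr fun _ => rfl

/-- `rowDNF n i φ` with context `(n, i)`. [cite: AlekhnovichEtAl2001, §2, Lemma 2] -/
theorem codeFP_rowDNF : CodeFP (pairE (pairE natE natE) fE) fE (fun p => rowDNF p.1.1 p.1.2 p.2) :=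
  (map codeFP_rowTerm).congr fun _ => rfl

/-- `secFormula n c` with context `n`. [cite: AlekhnovichEtAl2001, §2, Lemma 2] -/
theorem codeFP_secFormula : CodeFP (pairE natE (rawE qE)) fE (fun p => secFormula p.1 p.2) := by
  have hg : CodeFP (pairE natE qE) fE (fun q => rowDNF q.1 q.2.1 q.2.2) :=
    codeFP_rowDNF.comp (((fst _ _).pair (snd _ _).fst').pair (snd _ _).snd')
  exact ((flatten tE).comp (map hg)).congr fun p => by simp [secFormula, List.flatMap_def]

/-- The product `t ×ˢ Φ` of a term with the collection. [folklore] -/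
theorem codeFP_product : CodeFP (pairE tE (rawE fE)) (rawE qE) (fun p => p.1 ×ˢ p.2) := by
  have hin : CodeFP (pairE natE (rawE fE)) (rawE qE) (fun p => p.2.map (Prod.mk p.1)) :=
    map ((fst _ _).pair (snd _ _))
  have hout : CodeFP (pairE (rawE fE) tE) (rawE (rawE qE)) (fun p => p.2.map fun a => p.1.map (Prod.mk a)) :=
    map (hin.comp ((snd _ _).pair (fst _ _)))
  exact ((flatten qE).comp (hout.comp ((snd _ _).pair (fst _ _)))).congr fun p => by
    simp [SProd.sprod, List.product, List.flatMap_def]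

/-- `choices Φ φ` with context `Φ`. [folklore] -/
theorem codeFP_choices : CodeFP (pairE (rawE fE) fE) (rawE (rawE qE)) (fun p => choices p.1 p.2) :=
  (map (codeFP_product.comp ((snd _ _).pair (fst _ _)))).congr fun _ => rfl

/-- **Truncated sections on raw codes**, by induction on the depth. [cite: AroraBarak2009, §1.3 (a constant number of polynomial stages)] -/
theorem codeFP_sectionsK {α : Type} (eα : α → List Bool) :
    ∀ K : ℕ, CodeFP (rawE (rawE eα)) (rawE (rawE eα)) (sectionsK K)
  | 0 => (const _ [[]]).congr fun L => (sectionsK_zero L).symm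
  | K + 1 => by
    -- `(s, l) ↦ l.map (a :: s)`
    have hcons : CodeFP (pairE (rawE eα) (rawE eα)) (rawE (rawE eα)) (fun q => q.2.map fun a => a :: q.1) :=
      map ((rawCons eα).comp ((snd _ _).pair (fst _ _)))
    -- `(l, S) ↦ S.flatMap (fun s => l.map (a :: s))`
    have hstep : CodeFP (pairE (rawE eα) (rawE (rawE eα))) (rawE (rawE eα))
        (fun p => p.2.flatMap fun s => p.1.map fun a => a :: s) :=
      ((flatten (rawE eα)).comp (map (hcons.comp ((snd _ _).pair (fst _ _))))).congr fun p => by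
        simp [List.flatMap_def]
    have hrec := codeFP_sectionsK eα K
    have hc : CodeFP (pairE unitE (pairE (rawE eα) (rawE (rawE eα)))) (rawE (rawE eα))
        (fun t => (sectionsK K t.2.2).flatMap fun s => t.2.1.map fun a => a :: s) :=
      hstep.comp ((snd _ _).fst'.pair (hrec.comp (snd _ _).snd'))
    have h := rawCases (σ := Unit) (eσ := unitE) (k := fun _ L => sectionsK (K + 1) L)
      (gnil := fun _ => [[]]) (gcons := fun t => (sectionsK K t.2.2).flatMap fun s => t.2.1.map fun a => a :: s)
      (const unitE [[]]) hc (fun _ => rfl) (fun _ _ _ => rfl)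
    exact (h.comp ((const _ ()).pair (CodeFP.id _))).congr fun _ => rfl

/-- `nontriv` on raw collections. [folklore] -/
theorem codeFP_nontriv : CodeFP (rawE fE) (rawE fE) nontriv := by
  have hany : CodeFP (pairE unitE fE) bitE (fun q => q.2.any List.isEmpty) :=
    (any ((rawIsEmpty natE).comp (snd unitE tE))).congr fun _ => rfl
  have h := filter (σ := Unit) (eσ := unitE) hany.not
  exact (h.comp ((const _ ()).pair (CodeFP.id _))).congr fun Φ => rfl

/-- **The formulas of the squared instance, with context `n`.** [cite: AlekhnovichEtAl2001, §2, Lemma 2] -/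
theorem codeFP_sqFormulas (K : ℕ) : CodeFP (pairE natE (rawE fE)) (rawE fE) (fun p => sqFormulas K p.1 p.2) := by
  -- context `(n, Φₙ)`, item `φ ↦ (sectionsK K (choices Φₙ φ)).map (secFormula n)`
  have hper : CodeFP (pairE (pairE natE (rawE fE)) fE) (rawE fE)
      (fun p => (sectionsK K (choices p.1.2 p.2)).map (secFormula p.1.1)) :=
    (map codeFP_secFormula).comp ((fst _ _).fst'.pair
      ((codeFP_sectionsK qE K).comp (codeFP_choices.comp ((fst _ _).snd'.pair (snd _ _)))))
  have hΦn : CodeFP (pairE natE (rawE fE)) (rawE fE) (fun p => nontriv p.2) := codeFP_nontriv.comp (snd _ _)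
  exact ((flatten fE).comp ((map hper).comp (((fst _ _).pair hΦn).pair hΦn))).congr fun p => by
    simp [sqFormulas, List.flatMap_def]

/-! ### The instance map -/

/-- **The squaring map on tuples, `(n, Φ, w, s) ↦ (n², sqFormulas K n Φ, sqWeight w, s²)`, is
polynomial time on codes.** [cite: AlekhnovichEtAl2001, §2, Lemma 2; AroraBarak2009, §1.3] -/
theorem codeFP_sqT (K : ℕ) :
    CodeFP toE toE (fun t : TO => ((t.1 * t.1, sqFormulas K t.1 t.2.1, sqWeight t.2.2.1, t.2.2.2 * t.2.2.2) : TO)) := by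
  have hn : CodeFP toE natE (fun t => t.1) := fst _ _
  have hΦ : CodeFP toE (rawE fE) (fun t => t.2.1) := (codeFP_collRaw.comp (snd _ _).fst').congr fun _ => rfl
  have hw : CodeFP toE (rawE unE) (fun t => t.2.2.1) := (rawOfList unE).comp (snd _ _).snd'.fst'
  have hs : CodeFP toE natE (fun t => t.2.2.2) := (snd _ _).snd'.snd'
  have h1 : CodeFP toE natE (fun t => t.1 * t.1) := natMul.comp (hn.pair hn)
  have h2 : CodeFP toE (listE (listE (listE natE))) (fun t => sqFormulas K t.1 t.2.1) :=
    (codeFP_collList.comp ((codeFP_sqFormulas K).comp (hn.pair hΦ))).congr fun _ => rfl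
  have h3 : CodeFP toE (listE unE) (fun t => sqWeight t.2.2.1) :=
    ((listOfRaw unE).comp (codeFP_sqWeight.comp hw)).congr fun _ => rfl
  have h4 : CodeFP toE natE (fun t => t.2.2.2 * t.2.2.2) := natMul.comp (hs.pair hs)
  exact (h1.pair (h2.pair (h3.pair h4))).congr fun _ => rfl

/-- **`square K` is computed on codes (`CMMSAInstance.encoding`) by a polynomial-time string
function.** [cite: AlekhnovichEtAl2001, §2, Lemma 2 ("|φ₁ ∗ φ₂| ≤ |φ₁| · |φ₂|", a polynomial-time composition); AroraBarak2009, §1.3] -/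
theorem codeFP_square (K : ℕ) :
    CodeFP CMMSAInstance.encoding.encode CMMSAInstance.encoding.encode (square K) := by
  obtain ⟨f, hf, hfd⟩ := codeFP_sqT K
  refine ⟨f, hf, fun I => ?_⟩
  rw [CMMSAInstance.encoding_encode, CMMSAInstance.encoding_encode, toE_eq, hfd]
  rfl

/-! ### The Karp reductions -/

/-- **Self-improvement as a Karp reduction of promise problems**: for a constant gap `g ≥ 1` and a
constant degree bound `K`, `gapCMMSA g 1 K ≤ₚ gapCMMSA g² 1 (K · K)`.
[cite: AlekhnovichEtAl2001, §2, Lemma 2 (self-improvement property)] -/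
theorem polyTimeReducible_square (K : ℕ) {g : ℝ} (hg : 1 ≤ g) :
    (gapCMMSA (fun _ => g) (fun _ => 1) fun _ => K).PolyTimeReducible
      (gapCMMSA (fun _ => g ^ 2) (fun _ => 1) fun _ => K * K) := by
  obtain ⟨f, hf, hfI⟩ := codeFP_square K
  refine ⟨f, hf, ?_, ?_⟩
  · intro v hv
    rw [gapCMMSA_yes] at hv
    obtain ⟨I, hI, rfl⟩ := hv
    rw [hfI, gapCMMSA_yes]
    exact Set.mem_image_of_mem _ (square_mem_yesSet hI)
  · intro v hv
    rw [gapCMMSA_no] at hv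
    obtain ⟨I, hI, rfl⟩ := hv
    rw [hfI, gapCMMSA_no]
    exact Set.mem_image_of_mem _ (square_mem_noSet hg hI)

/-- **Iterated self-improvement**: `gapCMMSA g 1 K ≤ₚ gapCMMSA (g^(2^r)) 1 (K^(2^r))` for every
`r` (a constant number of squarings; ABMP, proof of Thm. 3: "applying self-improvement `k` times
… the new gap is at least `2^k`"). [cite: AlekhnovichEtAl2001, §2, proof of Thm. 3] -/
theorem polyTimeReducible_iterate (K : ℕ) {g : ℝ} (hg : 1 ≤ g) :
    ∀ r : ℕ, (gapCMMSA (fun _ => g) (fun _ => 1) fun _ => K).PolyTimeReducible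
      (gapCMMSA (fun _ => g ^ (2 ^ r)) (fun _ => 1) fun _ => K ^ (2 ^ r))
  | 0 => by simpa using PromiseProblem.PolyTimeReducible.refl _
  | r + 1 => by
    have h1 := polyTimeReducible_iterate K hg r
    have hgr : 1 ≤ g ^ (2 ^ r) := one_le_pow₀ hg
    have h2 := polyTimeReducible_square (K ^ (2 ^ r)) hgr
    have hg' : (g ^ (2 ^ r)) ^ 2 = g ^ (2 ^ (r + 1)) := by rw [← pow_mul, pow_succ]
    have hK' : K ^ (2 ^ r) * K ^ (2 ^ r) = K ^ (2 ^ (r + 1)) := by rw [← pow_two, ← pow_mul, pow_succ]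
    rw [hg', hK'] at h2
    exact PromiseProblem.PolyTimeReducible.trans_holds h1 h2

/-- **NP-hardness climbs the self-improvement ladder**: if `gapCMMSA g 1 K` is NP-hard for some
constant gap `g ≥ 1` and degree bound `K`, so is `gapCMMSA (g^(2^r)) 1 (K^(2^r))` for every `r`.
[cite: AlekhnovichEtAl2001, §2, Lemma 2 and proof of Thm. 3] -/
theorem isNPHard_gapCMMSA_iterate {K : ℕ} {g : ℝ} (hg : 1 ≤ g)
    (h : (gapCMMSA (fun _ => g) (fun _ => 1) fun _ => K).IsNPHard) (r : ℕ) :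
    (gapCMMSA (fun _ => g ^ (2 ^ r)) (fun _ => 1) fun _ => K ^ (2 ^ r)).IsNPHard :=
  PromiseProblem.IsHard.of_reducible_holds h (polyTimeReducible_iterate K hg r)

end CMMSASquare

end Literature.Computability.Complexity
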